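import Summits.RiemannHypothesis.RiemannHypothesis.Theorems.Splittings.ScrewKreinDiscreteCore

/-!
# Screw index transfer, discrete Kreĭn core (4/3, addendum): the unconditional LINEAR count

rh-split-screw-bridge g6, lane (xii-d), addendum file (cut of `xiid/ConcatCount.lean` §11; imports file 3/3).

* `ncard_offLine_le_of_indexBounded` : if `#{i | eig_i(screwMatrix n) < 0} ≤ K` for all `n`, then
  `{s | ζ s = 0 ∧ 0 < Re s < 1 ∧ Re s ≠ ½}.ncard ≤ 8 (K + 1)` — NO named fact (companion of the (xii-c-6) v2 bound
  `n₋(screwMatrix n) ≤ 2 · #off-line zeros`; together the two tail data agree up to a linear factor, in the kernel).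
* Route: §8 with sizes (`|Z_η| ≤ 4(K+1)`: `deg Pol ≤ 2 deg P ≤ 2(K+1)`, roots and their conjugate-inverses); the right-half
  zero set `rightZeros` is finite (two steps, file 3/3); for a finite set ONE small step `η = 1/(R+1)` (`R` a bound on the
  moduli) makes `w ↦ e^{ηw}` injective on it (`|η(w − w')| < 2 < 2π`), so `#rightZeros ≤ |Z_η| ≤ 4(K+1)`, and the off-line
  zeros are `½ + rightZeros` together with their reflections `1 − s`.

Classification tags: [folklore] = standard analysis/algebra; [new-combination] = assembled here.
HONEST LABEL: SPLITTING SEARCH over kernel-typed RH-EQUIVALENCES; the count relates two OPEN tail data (screw negative index,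
number of off-line zeros) and decides neither; nothing here bears on the truth of RH.
-/

noncomputable section

set_option linter.dupNamespace false

namespace Summit.RiemannHypothesis.RiemannHypothesis.Theorems.Splittings.ScrewKreinDiscrete

open Finset Complex MeasureTheory Set Filter Topology Polynomial Module
open scoped ComplexConjugate Matrix
open Literature.NumberTheory.LFunctions
open Literature.Analysis.OperatorTheory
open Literature.Analysis.OperatorTheory.KreinStewart
open Summit.RiemannHypothesis.RiemannHypothesis.Theses.RuelleBand
open Summit.RiemannHypothesis.RiemannHypothesis.Theorems.IntegerScrew
open Summit.RiemannHypothesis.RiemannHypothesis.Theorems.Splittings.ScrewKreinCore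
open Summit.RiemannHypothesis.RiemannHypothesis.Theorems.Splittings.ScrewIndexTransferKrein

/-! ## §11 (addendum) The unconditional LINEAR count: `#{distinct off-line zeros} ≤ 8 (K + 1)` -/

/-- §4 with the size of the confining set: `|Z| ≤ 2d`. [folklore] -/
theorem exists_finset_expSum_eq_zero_card (η : ℝ) (hη : η ≠ 0) (d : ℕ) (x : ℝ →₀ ℂ)
    (hsupp : ∀ t ∈ x.support, ∃ m : ℤ, t = m * η ∧ -(d : ℤ) ≤ m ∧ m ≤ d)
    (htop : x ((d : ℝ) * η) ≠ 0) :
    ∃ Z : Finset ℂ, Z.card ≤ 2 * d ∧ ∀ w : ℂ, expSum x w = 0 → cexp (η * w) ∈ Z := by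
  classical
  set I : Finset ℤ := Finset.Icc (-(d : ℤ)) d with hI
  set Pol : ℂ[X] := ∑ m ∈ I, Polynomial.C (x ((m : ℝ) * η)) * X ^ (m + d).toNat with hPol
  have hcoeff : Pol.coeff (2 * d) = x ((d : ℝ) * η) := by
    rw [hPol, Polynomial.finsetSum_coeff, Finset.sum_eq_single_of_mem (d : ℤ) (by rw [hI, Finset.mem_Icc]; omega)]
    · rw [Polynomial.coeff_C_mul, Polynomial.coeff_X_pow, if_pos (by omega), mul_one]
      norm_cast
    · intro m hm hmd
      rw [hI, Finset.mem_Icc] at hm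
      rw [Polynomial.coeff_C_mul, Polynomial.coeff_X_pow, if_neg (by omega), mul_zero]
  have hPol0 : Pol ≠ 0 := fun h => htop (by rw [← hcoeff, h, Polynomial.coeff_zero])
  have hdeg : Pol.natDegree ≤ 2 * d := by
    rw [hPol]
    refine Polynomial.natDegree_sum_le_of_forall_le _ _ fun m hm => ?_
    rw [hI, Finset.mem_Icc] at hm
    calc (Polynomial.C (x ((m : ℝ) * η)) * X ^ (m + d).toNat).natDegree ≤ (m + d).toNat :=
          Polynomial.natDegree_C_mul_X_pow_le _ _
      _ ≤ 2 * d := by omega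
  have hsum : ∀ w : ℂ, expSum x w = ∑ m ∈ I, x ((m : ℝ) * η) * cexp (w * (((m : ℝ) * η : ℝ) : ℂ)) := by
    intro w
    have hinj : ∀ m ∈ I, ∀ m' ∈ I, (fun m : ℤ => (m : ℝ) * η) m = (fun m : ℤ => (m : ℝ) * η) m' → m = m' := by
      intro m _ m' _ h
      have := mul_right_cancel₀ hη h
      exact_mod_cast this
    rw [expSum, ← Finset.sum_image (f := fun t : ℝ => x t * cexp (w * t)) hinj]
    refine Finset.sum_subset (fun t ht => ?_) (fun t _ ht => ?_)
    · obtain ⟨m, hm, hlo, hhi⟩ := hsupp t ht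
      exact Finset.mem_image.mpr ⟨m, by rw [hI, Finset.mem_Icc]; omega, hm.symm⟩
    · rw [Finsupp.notMem_support_iff.mp ht, zero_mul]
  have hid : ∀ w : ℂ, cexp ((d : ℂ) * (η * w)) * expSum x w = Pol.eval (cexp (η * w)) := by
    intro w
    rw [hsum, hPol, Polynomial.eval_finsetSum, Finset.mul_sum]
    refine Finset.sum_congr rfl fun m hm => ?_
    rw [hI, Finset.mem_Icc] at hm
    rw [Polynomial.eval_mul, Polynomial.eval_C, Polynomial.eval_pow, Polynomial.eval_X, ← Complex.exp_nat_mul,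
      mul_left_comm, ← Complex.exp_add]
    congr 2
    have : (((m + d).toNat : ℕ) : ℂ) = (m : ℂ) + d := by
      have h0 : 0 ≤ m + d := by omega
      have : (((m + d).toNat : ℤ) : ℂ) = ((m + d : ℤ) : ℂ) := by rw [Int.toNat_of_nonneg h0]
      push_cast at this ⊢
      exact this
    rw [this]
    push_cast
    ring
  refine ⟨Pol.roots.toFinset, ?_, fun w hw => ?_⟩
  · calc Pol.roots.toFinset.card ≤ Pol.roots.card := Multiset.toFinset_card_le _
      _ ≤ Pol.natDegree := Polynomial.card_roots' _
      _ ≤ 2 * d := hdeg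
  · rw [Multiset.mem_toFinset, Polynomial.mem_roots hPol0, Polynomial.IsRoot.def, ← hid, hw, mul_zero]

/-- §8 with the size of the confining set: `|Z| ≤ 4(K+1)`. [new-combination] -/
theorem exists_finset_exp_mem_card (K : ℕ)
    (hK : ∀ n : ℕ, (univ.filter fun i => (screwMatrix_isHermitian n).eigenvalues i < 0).card ≤ K)
    (η : ℝ) (hη : η ≠ 0) :
    ∃ Z : Finset ℂ, Z.card ≤ 4 * (K + 1) ∧
      ∀ w₀ : ℂ, 0 < w₀.re → riemannXi (1 / 2 + w₀) = 0 → cexp (η * w₀) ∈ Z := by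
  classical
  obtain ⟨P, hP0, hdegP, hpos⟩ := exists_definitizer K hK η
  set R : Module.End ℂ (ℝ →₀ ℂ) := aeval (SDOp η : Module.End ℂ (ℝ →₀ ℂ)) P with hR
  set ψ : ℝ →₀ ℂ := R (Finsupp.single 0 1) with hψ
  have hbd : ∀ a, ‖orbitFun ψ a‖ ≤ (BF fC ψ ψ).re := fun a =>
    norm_orbitFun_le R (fun a => commute_U_aeval a η P) hpos a
  obtain ⟨hsupp, htopv⟩ := aeval_single_support η hη P
  have hc0 : ((2 : ℂ) * Complex.I * η)⁻¹ ≠ 0 := by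
    refine inv_ne_zero (mul_ne_zero (mul_ne_zero two_ne_zero Complex.I_ne_zero) ?_)
    exact_mod_cast hη
  have htop : ψ ((P.natDegree : ℝ) * η) ≠ 0 := by
    rw [hψ, hR, htopv]
    exact mul_ne_zero (Polynomial.leadingCoeff_ne_zero.mpr hP0) (pow_ne_zero _ hc0)
  obtain ⟨Z₀, hZ₀c, hZ₀⟩ := exists_finset_expSum_eq_zero_card η hη P.natDegree ψ hsupp htop
  refine ⟨Z₀ ∪ Z₀.image fun z => (conj z)⁻¹, ?_, fun w₀ hw₀ hξ => ?_⟩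
  · have hi : (Z₀.image fun z : ℂ => (conj z)⁻¹).card ≤ Z₀.card := Finset.card_image_le
    have hu := Finset.card_union_le Z₀ (Z₀.image fun z : ℂ => (conj z)⁻¹)
    omega
  have hS := symb_eq_zero_of_zero ψ _ hbd hw₀ hξ
  rw [symb_eq_expSum, mul_eq_zero] at hS
  rcases hS with h | h
  · have h' : expSum ψ (-conj w₀) = 0 := by simpa using h
    have hmem := hZ₀ _ h'
    refine Finset.mem_union_right _ (Finset.mem_image.mpr ⟨_, hmem, ?_⟩)
    rw [show (η : ℂ) * -conj w₀ = conj (-(η * w₀)) by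
      rw [map_neg, map_mul, Complex.conj_ofReal]; ring, Complex.exp_conj, Complex.conj_conj,
      Complex.exp_neg, inv_inv]
  · exact Finset.mem_union_left _ (hZ₀ _ h)

/-- The right-half zero parameters `{w₀ : Re w₀ > 0, ξ(½ + w₀) = 0}`. -/
def rightZeros : Set ℂ := {w : ℂ | 0 < w.re ∧ riemannXi (1 / 2 + w) = 0}

/-- The off-line zero set sits inside `(½ + rightZeros) ∪ (1 − (½ + rightZeros))` (functional equation). [folklore] -/
theorem offLine_subset_rightZeros :
    {s : ℂ | riemannZeta s = 0 ∧ 0 < s.re ∧ s.re < 1 ∧ s.re ≠ 1 / 2} ⊆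
      ((fun w => 1 / 2 + w) '' rightZeros) ∪ ((fun z => 1 - z) '' ((fun w => 1 / 2 + w) '' rightZeros)) := by
  have key : ∀ s : ℂ, riemannZeta s = 0 → 0 < s.re → s.re < 1 → 1 / 2 < s.re →
      s ∈ (fun w => 1 / 2 + w) '' rightZeros := by
    intro s h0 h1 h2 h3
    have hξ : riemannXi (1 / 2 + (s - 1 / 2)) = 0 := by
      rw [show (1 / 2 : ℂ) + (s - 1 / 2) = s by ring]
      exact (riemannXi_eq_zero_iff_holds s).2 ⟨h0, h1, h2⟩
    have hw : 0 < (s - 1 / 2).re := by simp; linarith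
    exact ⟨s - 1 / 2, ⟨hw, hξ⟩, by ring⟩
  rintro s ⟨h0, h1, h2, h3⟩
  rcases lt_or_gt_of_ne h3 with hlt | hgt
  · right
    have hξ : riemannXi (1 - s) = 0 := by
      rw [riemannXi_one_sub]; exact (riemannXi_eq_zero_iff_holds s).2 ⟨h0, h1, h2⟩
    obtain ⟨h0', h1', h2'⟩ := (riemannXi_eq_zero_iff_holds (1 - s)).1 hξ
    refine ⟨1 - s, key (1 - s) h0' h1' h2' ?_, by ring⟩
    simp; linarith
  · exact Or.inl (key s h0 h1 h2 hgt)

/-- Under `IndexBounded`, `rightZeros` is finite (two steps, §9). [new-combination] -/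
theorem rightZeros_finite (K : ℕ)
    (hK : ∀ n : ℕ, (univ.filter fun i => (screwMatrix_isHermitian n).eigenvalues i < 0).card ≤ K) :
    rightZeros.Finite := by
  obtain ⟨Z₁, -, hZ₁⟩ := exists_finset_exp_mem_card K hK 1 one_ne_zero
  obtain ⟨Z₂, -, hZ₂⟩ := exists_finset_exp_mem_card K hK (Real.sqrt 2) (Real.sqrt_pos.mpr two_pos).ne'
  refine (finite_candidates Z₁ Z₂).subset fun w₀ ⟨hw₀, hξ⟩ => ⟨?_, hZ₂ w₀ hw₀ hξ⟩
  have := hZ₁ w₀ hw₀ hξ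
  simpa using this

/-- **Linear count of the right-half zeros**: once `rightZeros` is finite, ONE small generic step `η` makes `w ↦ e^{ηw}`
injective on it, so `#rightZeros ≤ |Z_η| ≤ 4(K+1)`. [new-combination] -/
theorem ncard_rightZeros_le (K : ℕ)
    (hK : ∀ n : ℕ, (univ.filter fun i => (screwMatrix_isHermitian n).eigenvalues i < 0).card ≤ K) :
    rightZeros.ncard ≤ 4 * (K + 1) := by
  have hfin := rightZeros_finite K hK
  obtain ⟨R, hR⟩ := (hfin.image fun w : ℂ => ‖w‖).bddAbove
  have hRw : ∀ w ∈ rightZeros, ‖w‖ ≤ R := fun w hw => hR (Set.mem_image_of_mem _ hw)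
  set R' : ℝ := max R 0 with hR'
  have hR'0 : 0 ≤ R' := le_max_right _ _
  set η : ℝ := 1 / (R' + 1) with hη
  have hηpos : 0 < η := by positivity
  obtain ⟨Z, hZc, hZ⟩ := exists_finset_exp_mem_card K hK η hηpos.ne'
  have hinj : Set.InjOn (fun w : ℂ => cexp (η * w)) rightZeros := by
    intro w hw w' hw' h
    obtain ⟨n, hn⟩ := Complex.exp_eq_exp_iff_exists_int.mp h
    have hdiff : (η : ℂ) * (w - w') = n * (2 * Real.pi * Complex.I) := by linear_combination hn
    by_cases hn0 : n = 0
    · rw [hn0, Int.cast_zero, zero_mul, mul_eq_zero, sub_eq_zero] at hdiff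
      exact hdiff.resolve_left (by exact_mod_cast hηpos.ne')
    · exfalso
      have h1 : ‖(η : ℂ) * (w - w')‖ < 2 := by
        rw [norm_mul, Complex.norm_real, Real.norm_eq_abs, abs_of_pos hηpos]
        have hw1 : ‖w‖ ≤ R' := (hRw w hw).trans (le_max_left _ _)
        have hw2 : ‖w'‖ ≤ R' := (hRw w' hw').trans (le_max_left _ _)
        have hsub : ‖w - w'‖ ≤ 2 * R' := (norm_sub_le _ _).trans (by linarith)
        calc η * ‖w - w'‖ ≤ η * (2 * R') := mul_le_mul_of_nonneg_left hsub hηpos.le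
          _ = 2 * R' / (R' + 1) := by rw [hη]; ring
          _ < 2 := by rw [div_lt_iff₀ (by positivity)]; linarith
      have h2 : (2 : ℝ) ≤ ‖(n : ℂ) * (2 * Real.pi * Complex.I)‖ := by
        rw [norm_mul, norm_mul, norm_mul, Complex.norm_I, mul_one, Complex.norm_intCast, Complex.norm_real,
          Real.norm_eq_abs, abs_of_pos Real.pi_pos, Complex.norm_two]
        have habs : (1 : ℝ) ≤ |(n : ℝ)| := by exact_mod_cast Int.one_le_abs hn0
        nlinarith [Real.pi_gt_three]
      rw [hdiff] at h1
      linarith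
  calc rightZeros.ncard ≤ (Z : Set ℂ).ncard :=
        Set.ncard_le_ncard_of_injOn (fun w : ℂ => cexp (η * w)) (fun w hw => hZ w hw.1 hw.2) hinj Z.finite_toSet
    _ = Z.card := Set.ncard_coe_finset Z
    _ ≤ 4 * (K + 1) := hZc

/-- **THE UNCONDITIONAL LINEAR COUNT.**  If the negative index of Suzuki's screw node matrices is bounded by `K`, then `ζ`
has at most `8 (K + 1)` DISTINCT zeros off the critical line (companion of the staged (xii-c-6) bound `K⋆ ≤ 2N`; together:
the screw negative index and the number of distinct off-line zeros are the same datum up to a linear factor, in the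
kernel, with NO named fact). [new-combination] -/
theorem ncard_offLine_le_of_indexBounded (K : ℕ)
    (hK : ∀ n : ℕ, (univ.filter fun i => (screwMatrix_isHermitian n).eigenvalues i < 0).card ≤ K) :
    {s : ℂ | riemannZeta s = 0 ∧ 0 < s.re ∧ s.re < 1 ∧ s.re ≠ 1 / 2}.ncard ≤ 8 * (K + 1) := by
  have hfin := rightZeros_finite K hK
  have hA : ((fun w : ℂ => 1 / 2 + w) '' rightZeros).Finite := hfin.image _
  have hB : ((fun z : ℂ => 1 - z) '' ((fun w : ℂ => 1 / 2 + w) '' rightZeros)).Finite := hA.image _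
  have hcnt := ncard_rightZeros_le K hK
  calc {s : ℂ | riemannZeta s = 0 ∧ 0 < s.re ∧ s.re < 1 ∧ s.re ≠ 1 / 2}.ncard
      ≤ (((fun w : ℂ => 1 / 2 + w) '' rightZeros) ∪
          ((fun z : ℂ => 1 - z) '' ((fun w : ℂ => 1 / 2 + w) '' rightZeros))).ncard :=
        Set.ncard_le_ncard offLine_subset_rightZeros (hA.union hB)
    _ ≤ ((fun w : ℂ => 1 / 2 + w) '' rightZeros).ncard +
          ((fun z : ℂ => 1 - z) '' ((fun w : ℂ => 1 / 2 + w) '' rightZeros)).ncard := Set.ncard_union_le _ _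
    _ ≤ rightZeros.ncard + rightZeros.ncard :=
        add_le_add (Set.ncard_image_le hfin) ((Set.ncard_image_le hA).trans (Set.ncard_image_le hfin))
    _ ≤ 8 * (K + 1) := by omega

end Summit.RiemannHypothesis.RiemannHypothesis.Theorems.Splittings.ScrewKreinDiscrete
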